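import Summits.ValiantsHypothesis.ValiantsHypothesis.Theorems.NewtonUnitEquationsTwoProductsRaySplitSpan
import Summits.ValiantsHypothesis.ValiantsHypothesis.Theorems.NewtonUnitEquationsTwoProductsSeparated
import Summits.ValiantsHypothesis.ValiantsHypothesis.Theorems.NewtonUnitEquationsTwoProductsFormalLogLinearisationStubLogLinearisation
import HarnessLib

/-!
# R11 (`freiman-ray-split`; Stage 1) — parts C+D: the VALUATION BOX and `RaySplitLaw`
(C) Per ray `i`, an echelon basis (`Separated.exists_echelon_fintype`, ≤ 2^{m+1} pivots) of the span of the pure polynomials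
`∏_{j∈U} Uray (cU j) i`, `∏_{j∈U} Uray (cV j) i`; the `Z_i`-slice of `GT` through a strict `θ`-minimiser `x₀` is a nonzero element of that
span whose least exponent is `x₀ i` (a smaller one would be `θ`-smaller, `θ_i > 0` on rays carrying a letter), hence `x₀ i` is a PIVOT
exponent (`exists_min_pivot`).  (D) `visible ↪ ∏_i pivots_i`, so `(visible u v).ncard ≤ 2^{(m+1)K}` — ★ `raySplitLaw_holds : RaySplitLaw` and
★ `raySplitCellLaw_holds : RaySplitCellLaw` (via `stub_logLinearisation`).  Second hand val-lit-p3 g16 (draft for / with first hand val-port-3 g2).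
R11 is a proper positive sub-case rung (K rays in the exponent); nothing here closes 5906; VP ≠ VNP is NOT proved.
-/

noncomputable section
set_option linter.dupNamespace false
set_option linter.unusedSectionVars false

namespace Summit.ValiantsHypothesis.ValiantsHypothesis.Theorems.NewtonUnitEquations.TwoProducts.PermutationType
namespace R11
open scoped BigOperators
open MvPolynomial
open Summit.ValiantsHypothesis.ValiantsHypothesis.Theorems.NewtonUnitEquations.TwoProducts.FormalLogLinearisation
open Summit.ValiantsHypothesis.ValiantsHypothesis.Theorems.NewtonUnitEquations.TwoProducts.PlanarCell
open Summit.ValiantsHypothesis.ValiantsHypothesis.Theorems.NewtonUnitEquations.TwoProducts.RaySplit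
open Summit.ValiantsHypothesis.ValiantsHypothesis.Theorems.TwoProducts.Separated

section Valuation
variable {m K : ℕ}
variable (u v : Fin m → MvPolynomial (Fin 2) ℂ) (g : Fin K → Expo) (ι : Expo → Fin K) (ν : Expo → ℕ)

/-- The index type of the pure family on a ray: `u`-side and `v`-side subsets. [folklore] -/
abbrev FIdx (m : ℕ) := Finset (Fin m) ⊕ Finset (Fin m)

/-- The pure family on ray `i`: `∏_{j∈U} Uray (cU j) i` and `∏_{j∈U} Uray (cV j) i`. [val-idea-32] -/
def fam (i : Fin K) : FIdx m → MvPolynomial (Fin K) ℂ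
  | Sum.inl U => ∏ j ∈ U, Uray u v ι ν (cU u v j) i
  | Sum.inr U => ∏ j ∈ U, Uray u v ι ν (cV u v j) i

/-- Every member of the family is `Z_i`-pure. [folklore] -/
theorem pure_fam (i : Fin K) (idx : FIdx m) : Pure i (fam u v ι ν i idx) := by
  rcases idx with U | U
  · exact pure_prod i U _ fun j _ => pure_Uray u v ι ν _ i
  · exact pure_prod i U _ fun j _ => pure_Uray u v ι ν _ i

/-- A pure exponent is the single of its `i`-th coordinate. [folklore] -/
theorem eq_single_of_pure {i : Fin K} {P : MvPolynomial (Fin K) ℂ} (hP : Pure i P) {q : Fin K →₀ ℕ} (hq : q ∈ P.support) :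
    q = Finsupp.single i (q i) := by
  ext i'
  by_cases h : i' = i
  · subst h; simp
  · rw [hP q hq i' h, Finsupp.single_apply, if_neg (fun hh => h hh.symm)]

/-- `lwt` of a single. [folklore] -/
theorem lwt_single (θ : Fin K → ℝ) (i : Fin K) (a : ℕ) : lwt θ (Finsupp.single i a) = θ i * a := by
  classical
  unfold lwt
  rw [Finset.sum_eq_single i]
  · simp
  · intro t _ ht; rw [Finsupp.single_apply, if_neg (fun h => ht h.symm)]; simp
  · intro h; exact absurd (Finset.mem_univ i) h

/-- A positive `i`-coordinate of a lifted exponent comes from a letter on ray `i`. [folklore] -/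
theorem exists_letter_of_pos (L : Fin (sE u v) →₀ ℕ) (i : Fin K) (h : 0 < piT (M u v ι ν) L i) :
    ∃ k : Fin (sE u v), ι (enum u v k) = i := by
  classical
  rw [piT_M_apply] at h
  obtain ⟨k, -, hk⟩ := Finset.exists_ne_zero_of_sum_ne_zero h.ne'
  by_cases hki : ι (enum u v k) = i
  · exact ⟨k, hki⟩
  · rw [if_neg hki, mul_zero] at hk; exact absurd rfl hk

/-- **The valuation box on ray `i`**: a finset of at most `2^{m+1}` naturals containing the `i`-th coordinate of every strict
`θ`-minimiser of the lifted support, for every weight `θ` positive on the rays that carry a letter. [val-idea-32, Stage 1] -/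
theorem exists_pivots (i : Fin K) :
    ∃ Piv : Finset ℕ, Piv.card ≤ 2 ^ (m + 1) ∧
      ∀ (θ : Fin K → ℝ), (∀ k : Fin (sE u v), 0 < θ (ι (enum u v k))) →
      ∀ x₀ ∈ (GT u v ι ν).support, (∀ x ∈ (GT u v ι ν).support, x ≠ x₀ → lwt θ x₀ < lwt θ x) → x₀ i ∈ Piv := by
  classical
  -- echelon basis of the pure family
  set Usup : Finset (Fin K →₀ ℕ) := Finset.univ.biUnion fun idx : FIdx m => (fam u v ι ν i idx).support with hUsup
  have hpureU : ∀ q ∈ Usup, q = Finsupp.single i (q i) := by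
    intro q hq
    obtain ⟨idx, -, hq⟩ := Finset.mem_biUnion.mp hq
    exact eq_single_of_pure (pure_fam u v ι ν i idx) hq
  have hω : ∀ q ∈ Usup, ∀ q' ∈ Usup, ((q i : ℕ) : ℤ) = ((q' i : ℕ) : ℤ) → q = q' := by
    intro q hq q' hq' h
    rw [hpureU q hq, hpureU q' hq']
    have : q i = q' i := by exact_mod_cast h
    rw [this]
  obtain ⟨r, F, p, hr, hspan, hFU, hp, hpinj⟩ :=
    exists_echelon_fintype (K := ℂ) Usup (fun q => ((q i : ℕ) : ℤ)) hω (fam u v ι ν i)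
      (fun idx => Finset.subset_biUnion_of_mem (fun idx : FIdx m => (fam u v ι ν i idx).support) (Finset.mem_univ idx))
  refine ⟨Finset.univ.image fun ρ => (p ρ) i, ?_, ?_⟩
  · calc (Finset.univ.image fun ρ => (p ρ) i).card ≤ (Finset.univ : Finset (Fin r)).card := Finset.card_image_le
      _ = r := by simp
      _ ≤ Fintype.card (FIdx m) := hr
      _ = 2 ^ (m + 1) := by simp [FIdx, Fintype.card_sum, Fintype.card_finset, pow_succ]; ring
  · intro θ hθ x₀ hx₀ hmin
    -- decompose x₀ = e + (x₀ i)·δ_i with e i = 0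
    set e : Fin K →₀ ℕ := x₀.erase i with he
    have hei : e i = 0 := by rw [he]; simp
    have hx₀e : x₀ = e + Finsupp.single i (x₀ i) := by
      rw [he]; ext i'
      by_cases h : i' = i
      · subst h; simp
      · rw [Finsupp.add_apply, Finsupp.erase_ne h, Finsupp.single_apply, if_neg (fun hh => h hh.symm), add_zero]
    -- the slice as a combination of the family
    let coefU : FIdx m → ℂ := fun idx => match idx with
      | Sum.inl U => coeff e (∏ j ∈ Finset.univ \ U, W u v ι ν (cU u v j) i)
      | Sum.inr U => -coeff e (∏ j ∈ Finset.univ \ U, W u v ι ν (cV u v j) i)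
    set S : MvPolynomial (Fin K) ℂ := ∑ idx, coefU idx • fam u v ι ν i idx with hS
    have hScoeff : ∀ n, coeff (Finsupp.single i n) S = coeff (e + Finsupp.single i n) (GT u v ι ν) := by
      intro n
      rw [hS, coeff_sum, coeff_GT_slice u v ι ν i e hei n, Finset.powerset_univ, Fintype.sum_sum_type, sub_eq_add_neg,
        ← Finset.sum_neg_distrib]
      congr 1
      all_goals exact Finset.sum_congr rfl fun U _ => by simp only [coeff_smul, smul_eq_mul, fam, coefU, neg_mul]
    have hSmem : S ∈ Submodule.span ℂ (Set.range F) :=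
      Submodule.sum_mem _ fun idx _ => Submodule.smul_mem _ _ (hspan idx)
    obtain ⟨d, hd⟩ := (Submodule.mem_span_range_iff_exists_fun ℂ).mp hSmem
    have hSne : ∑ ρ, d ρ • F ρ ≠ 0 := by
      rw [hd]
      intro h0
      have := hScoeff (x₀ i)
      rw [h0, coeff_zero, ← hx₀e] at this
      exact (mem_support_iff.mp hx₀) this.symm
    obtain ⟨ρ, hρS, hρmin⟩ := exists_min_pivot F p (fun q => ((q i : ℕ) : ℤ)) hp hpinj d hSne
    rw [hd] at hρS hρmin
    -- the pivot exponent is pure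
    have hpρ : p ρ = Finsupp.single i ((p ρ) i) := hpureU _ (hFU ρ (hp ρ).1)
    -- x₀ i is in the support of the slice
    have hxS : Finsupp.single i (x₀ i) ∈ S.support := by
      rw [mem_support_iff, hScoeff, ← hx₀e]; exact mem_support_iff.mp hx₀
    have hle : (p ρ) i ≤ x₀ i := by
      have := hρmin _ hxS
      simp only [Finsupp.single_eq_same] at this
      exact_mod_cast this
    -- and it cannot exceed the pivot: otherwise the pivot point is θ-smaller
    have hge : x₀ i ≤ (p ρ) i := by
      by_contra hlt
      push Not at hlt
      set n₀ := (p ρ) i with hn₀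
      have hx'supp : e + Finsupp.single i n₀ ∈ (GT u v ι ν).support := by
        rw [mem_support_iff, ← hScoeff, ← hpρ]; exact mem_support_iff.mp hρS
      have hne : e + Finsupp.single i n₀ ≠ x₀ := by
        intro h
        have := congrArg (fun f : Fin K →₀ ℕ => f i) h
        simp only [Finsupp.add_apply, hei, Finsupp.single_eq_same, zero_add] at this
        omega
      have hlt2 := hmin _ hx'supp hne
      -- θ i > 0: x₀ i ≥ 1 forces a letter on ray i
      obtain ⟨L₀, -, hL₀⟩ := exists_of_mem_support_phiT (M u v ι ν) _ x₀ hx₀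
      have hpos : 0 < piT (M u v ι ν) L₀ i := by rw [hL₀]; omega
      obtain ⟨k, hk⟩ := exists_letter_of_pos u v ι ν L₀ i hpos
      have hθi : 0 < θ i := by rw [← hk]; exact hθ k
      rw [hx₀e, lwt_add, lwt_add, lwt_single, lwt_single] at hlt2
      have : (n₀ : ℝ) < (x₀ i : ℝ) := by exact_mod_cast hlt
      nlinarith
    exact Finset.mem_image.mpr ⟨ρ, Finset.mem_univ ρ, by omega⟩

end Valuation

section Law
variable {m K : ℕ}

/-- Weights of a valid `ξ` are positive on every ray carrying a letter: `θ i = −wt ξ (g i) > 0`. [folklore] -/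
theorem theta_pos (u v : Fin m → MvPolynomial (Fin 2) ℂ) (g : Fin K → Expo) (ι : Expo → Fin K) (ν : Expo → ℕ)
    (hu : ∀ j, coeff 0 (u j) = 0) (hv : ∀ j, coeff 0 (v j) = 0) (hon : OnRays g ι ν (tailSupport u v))
    (ξ : Fin 2 → ℝ) (hval : ValidWeight u v ξ) (k : Fin (sE u v)) : 0 < -wt ξ (g (ι (enum u v k))) := by
  have hneg := wt_enum_neg u v ξ hval k
  have he := hon _ (enum_mem u v k)
  have hν : 0 < ν (enum u v k) := by
    by_contra h; push Not at h
    have h0 : ν (enum u v k) = 0 := by omega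
    rw [h0, zero_smul] at he
    exact enum_ne_zero u v hu hv k he
  rw [he, wt_nsmul] at hneg
  have : (0 : ℝ) < ν (enum u v k) := by exact_mod_cast hν
  nlinarith

/-- **The box**: a finset of planar points of size `≤ 2^{(m+1)K}` containing every strict top of the tail support. [val-idea-32, Stage 1] -/
theorem exists_box (u v : Fin m → MvPolynomial (Fin 2) ℂ) (g : Fin K → Expo) (ι : Expo → Fin K) (ν : Expo → ℕ)
    (hu : ∀ j, coeff 0 (u j) = 0) (hv : ∀ j, coeff 0 (v j) = 0) (hon : OnRays g ι ν (tailSupport u v))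
    (hcf : RayCrossFree ι (fun j => (u j).support ∪ (v j).support)) :
    ∃ B : Finset Expo, B.card ≤ 2 ^ ((m + 1) * K) ∧
      ∀ l : Expo, (∃ ξ : Fin 2 → ℝ, ValidWeight u v ξ ∧ IsStrictTop ξ ↑(tailDiff u v).support l) → l ∈ B := by
  classical
  have H := fun i : Fin K => exists_pivots u v ι ν (m := m) i
  choose Piv hcard hPiv using H
  refine ⟨(Fintype.piFinset Piv).image fun f => piE g (Finsupp.equivFunOnFinite.symm f), ?_, ?_⟩
  · calc _ ≤ (Fintype.piFinset Piv).card := Finset.card_image_le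
      _ = ∏ i, (Piv i).card := Fintype.card_piFinset Piv
      _ ≤ ∏ _i : Fin K, 2 ^ (m + 1) := Finset.prod_le_prod' fun i _ => hcard i
      _ = 2 ^ ((m + 1) * K) := by rw [Finset.prod_const, Finset.card_univ, Fintype.card_fin, ← pow_mul]
  · rintro l ⟨ξ, hval, htop⟩
    obtain ⟨x₀, hx₀, hπ, hmin⟩ := lifted_of_visible u v g ι ν hu hv hon hcf ξ l htop
    have hθ : ∀ k : Fin (sE u v), 0 < (fun i => -wt ξ (g i)) (ι (enum u v k)) := fun k =>
      theta_pos u v g ι ν hu hv hon ξ hval k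
    refine Finset.mem_image.mpr ⟨⇑x₀, Fintype.mem_piFinset.mpr fun i => hPiv i _ hθ x₀ hx₀ hmin, ?_⟩
    rw [← hπ]; congr 1; ext a; simp

/-- **R11, STAGE 1 — THE RAY-SPLIT LAW** (`#visible ≤ 2^{(m+1)K}`, t-free, any in-ray rank). [val-idea-32; second hand val-lit-p3 g16] -/
theorem raySplitLaw_holds : RaySplitLaw := by
  intro K m g ι ν u v _ hu hv hon hcf
  obtain ⟨B, hB, hmem⟩ := exists_box u v g ι ν hu hv hon hcf
  have hsub : visible u v ⊆ ↑B := fun l hl => hmem l hl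
  calc (visible u v).ncard ≤ (↑B : Set Expo).ncard := Set.ncard_le_ncard hsub (Finset.finite_toSet B)
    _ = B.card := Set.ncard_coe_finset B
    _ ≤ 2 ^ ((m + 1) * K) := hB

/-- **R11, STAGE 1 — cell form.** [val-idea-32; second hand val-lit-p3 g16] -/
theorem raySplitCellLaw_holds : RaySplitCellLaw := by
  intro K m g ι ν u v _ hu hv hon hcf R S hS
  obtain ⟨B, hB, hmem⟩ := exists_box u v g ι ν hu hv hon hcf
  have hsub : S ⊆ B := fun l hl => by
    obtain ⟨ξ, hval, htop, -⟩ := hS l hl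
    exact hmem l ⟨ξ, hval, (stub_logLinearisation m u v hu hv ξ hval l).2 htop⟩
  exact (Finset.card_le_card hsub).trans hB

/-- **R11, Stage 1 — cell form WITHOUT `IndepRays`** (the independence of the ray directions is not needed: rays carrying a letter are
automatically nonzero, and Freiman injectivity uses only `OnRays` + `RayCrossFree`).  For later hatches (v24+) that wish to drop `IndepRays`.
[val-idea-32; val-lit-p3 g16] -/
theorem raySplitCellBound {m K : ℕ} (g : Fin K → Expo) (ι : Expo → Fin K) (ν : Expo → ℕ) (u v : Fin m → MvPolynomial (Fin 2) ℂ)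
    (hu : ∀ j, coeff 0 (u j) = 0) (hv : ∀ j, coeff 0 (v j) = 0) (hon : OnRays g ι ν (tailSupport u v))
    (hcf : RayCrossFree ι (fun j => (u j).support ∪ (v j).support)) (R : Expo → Expo → Prop) (S : Finset Expo)
    (hS : IsCellFamily u v R S) : S.card ≤ 2 ^ ((m + 1) * K) := by
  obtain ⟨B, hB, hmem⟩ := exists_box u v g ι ν hu hv hon hcf
  have hsub : S ⊆ B := fun l hl => by
    obtain ⟨ξ, hval, htop, -⟩ := hS l hl
    exact hmem l ⟨ξ, hval, (stub_logLinearisation m u v hu hv ξ hval l).2 htop⟩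
  exact (Finset.card_le_card hsub).trans hB

end Law

end R11
end Summit.ValiantsHypothesis.ValiantsHypothesis.Theorems.NewtonUnitEquations.TwoProducts.PermutationType

end
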